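import Mathlib.Topology.Baire.Lemmas
import Mathlib.Topology.Baire.CompleteMetrizable
import Mathlib.Topology.MetricSpace.Pseudo.Lemmas
import Summits.HubbardSuperconductivity.HubbardSuperconductivity.Theses.BalabanIR

/-!
# Crux `BirEveryGroundState` (item `stmt-HubbardSuperconductivity-2083`): Baire uniformisation of the window hypothesis

The hypothesis of `Theses.BalabanIR.BirEveryGroundState` (crux 5 of route BalabanIR) is a
POINTWISE-EVENTUAL statement over a window of couplings: for every `U ∈ (U₁, U₂)` there is a
threshold `L₀ = L₀(U)` beyond which (at even torus sides `L`) the sector ground-state average of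
`Δ_d† Δ_d` is at least `c·L⁴`. The threshold may depend on `U` in an arbitrary way. Every argument
that wants to pick ONE coupling good for all large `L` by a smallness-in-`U` count of the bad
couplings of each side `L` (rather than by their outright absence) needs a COMMON threshold on a
sub-window. The Baire category theorem supplies it for free, for an arbitrary predicate:

* `exists_Ioo_subset_closure_of_forall_eventually` — if `∀ U ∈ (U₁,U₂) ∃ L₀ ∀ L ≥ L₀, p U L`
  then some `L₀` works on a DENSE subset of some non-trivial sub-window `(a,b) ⊆ (U₁,U₂)`;
* `exists_Ioo_forall_of_forall_eventually_of_isClosed` — if moreover each `{U | p U L}` is closed,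
  the same `L₀` works at EVERY coupling of the sub-window;
* `birAvgHyp_uniform_on_dense_subwindow` — the first statement with `p` the verbatim window-average
  body of the crux / of the target `BirGroundStateAverageLRO`.

Nothing here asserts a Theses declaration; no definition is introduced. Baire (1899); Mathlib
`dense_iUnion_interior_of_closed`. [folklore]
-/

noncomputable section

-- the mandated namespace `Summit.<Summit>.<Problem>.Theorems` repeats `HubbardSuperconductivity`
-- (single-problem summit, D-0017), which the `dupNamespace` linter flags on every declaration
set_option linter.dupNamespace false

namespace Summit.HubbardSuperconductivity.HubbardSuperconductivity.Theorems

open Matrix Finset Filter Set Metric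
open Literature.MathematicalPhysics.QuantumLattice
open Summit.HubbardSuperconductivity.HubbardSuperconductivity.Theses.BalabanIR

/-- **Baire uniformisation (dense form).** Let `p : ℝ → ℕ → Prop` be any predicate and suppose
that at every point `U` of a non-trivial open window `(U₁, U₂)` it holds eventually in `L`:
`∃ L₀, ∀ L ≥ L₀, p U L`, the threshold depending on `U`. Then there are ONE threshold `L₀` and a
non-trivial sub-window `(a, b) ⊆ (U₁, U₂)` such that the couplings `U ∈ (U₁, U₂)` at which
`p U L` holds for all `L ≥ L₀` are DENSE in `(a, b)`. Proof: the sets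
`A_n = {U ∈ (U₁,U₂) | ∀ L ≥ n, p U L}` cover the window, so the closed sets
`closure A_n ∪ (U₁,U₂)ᶜ` cover `ℝ`; by Baire one of them has an interior point inside the window.
Baire (1899). [folklore] -/
theorem exists_Ioo_subset_closure_of_forall_eventually {U₁ U₂ : ℝ} (hU : U₁ < U₂)
    (p : ℝ → ℕ → Prop) (h : ∀ U ∈ Set.Ioo U₁ U₂, ∃ L₀ : ℕ, ∀ L, L₀ ≤ L → p U L) :
    ∃ (L₀ : ℕ) (a b : ℝ), U₁ < a ∧ a < b ∧ b < U₂ ∧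
      Set.Ioo a b ⊆ closure {U | U ∈ Set.Ioo U₁ U₂ ∧ ∀ L, L₀ ≤ L → p U L} := by
  classical
  set A : ℕ → Set ℝ := fun n => {U | U ∈ Set.Ioo U₁ U₂ ∧ ∀ L, n ≤ L → p U L} with hA
  let f : ℕ → Set ℝ := fun n => closure (A n) ∪ (Set.Ioo U₁ U₂)ᶜ
  have hclosed : ∀ n, IsClosed (f n) := fun n =>
    isClosed_closure.union isOpen_Ioo.isClosed_compl
  have hcover : (⋃ n, f n) = Set.univ := by
    refine Set.eq_univ_of_forall fun U => ?_
    by_cases hUW : U ∈ Set.Ioo U₁ U₂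
    · obtain ⟨L₀, hL₀⟩ := h U hUW
      exact Set.mem_iUnion.mpr ⟨L₀, Or.inl (subset_closure ⟨hUW, hL₀⟩)⟩
    · exact Set.mem_iUnion.mpr ⟨0, Or.inr hUW⟩
  have hdense : Dense (⋃ n, interior (f n)) := dense_iUnion_interior_of_closed hclosed hcover
  obtain ⟨x, hx, hxW⟩ := hdense.exists_mem_open isOpen_Ioo (Set.nonempty_Ioo.mpr hU)
  obtain ⟨n, hn⟩ := Set.mem_iUnion.mp hx
  have hopen : IsOpen (interior (f n) ∩ Set.Ioo U₁ U₂) := isOpen_interior.inter isOpen_Ioo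
  obtain ⟨ε, hε, hball⟩ := Metric.isOpen_iff.mp hopen x ⟨hn, hxW⟩
  -- every point of the ball lies in the window and in `closure (A n)`
  have hballW : ∀ y, |y - x| < ε → y ∈ Set.Ioo U₁ U₂ ∧ y ∈ closure (A n) := by
    intro y hy
    have hyb : y ∈ ball x ε := by simpa [Metric.mem_ball, Real.dist_eq] using hy
    have hy' := hball hyb
    refine ⟨hy'.2, ?_⟩
    rcases interior_subset hy'.1 with h1 | h2
    · exact h1
    · exact absurd hy'.2 h2
  have hlo : x - ε / 2 ∈ Set.Ioo U₁ U₂ :=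
    (hballW (x - ε / 2) (by rw [abs_lt]; constructor <;> linarith)).1
  have hhi : x + ε / 2 ∈ Set.Ioo U₁ U₂ :=
    (hballW (x + ε / 2) (by rw [abs_lt]; constructor <;> linarith)).1
  refine ⟨n, x - ε / 2, x + ε / 2, hlo.1, by linarith, hhi.2, fun y hy => ?_⟩
  have hyx : |y - x| < ε := by
    rw [abs_lt]; constructor <;> linarith [hy.1, hy.2]
  exact (hballW y hyx).2

/-- **Baire uniformisation (closed form).** If, in the situation of
`exists_Ioo_subset_closure_of_forall_eventually`, every slice `{U | p U L}` is closed in `ℝ`, then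
ONE threshold `L₀` works at EVERY coupling of a non-trivial sub-window:
`∀ U ∈ (a, b), ∀ L ≥ L₀, p U L`. (A dense subset of `(a,b)` of the closed set `⋂_{L ≥ L₀} {p · L}`
forces the whole sub-window into it.) Baire (1899). [folklore] -/
theorem exists_Ioo_forall_of_forall_eventually_of_isClosed {U₁ U₂ : ℝ} (hU : U₁ < U₂)
    (p : ℝ → ℕ → Prop) (hc : ∀ L, IsClosed {U | p U L})
    (h : ∀ U ∈ Set.Ioo U₁ U₂, ∃ L₀ : ℕ, ∀ L, L₀ ≤ L → p U L) :
    ∃ (L₀ : ℕ) (a b : ℝ), U₁ < a ∧ a < b ∧ b < U₂ ∧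
      ∀ U ∈ Set.Ioo a b, ∀ L, L₀ ≤ L → p U L := by
  obtain ⟨L₀, a, b, ha, hab, hb, hsub⟩ :=
    exists_Ioo_subset_closure_of_forall_eventually hU p h
  refine ⟨L₀, a, b, ha, hab, hb, fun U hUab L hL => ?_⟩
  have hC : IsClosed (⋂ L, ⋂ (_ : L₀ ≤ L), {U | p U L}) :=
    isClosed_iInter fun L => isClosed_iInter fun _ => hc L
  have hincl : {U | U ∈ Set.Ioo U₁ U₂ ∧ ∀ L, L₀ ≤ L → p U L} ⊆
      ⋂ L, ⋂ (_ : L₀ ≤ L), {U | p U L} := by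
    intro V hV
    simp only [Set.mem_iInter, Set.mem_setOf_eq]
    exact fun L hL => hV.2 L hL
  have hmem : U ∈ ⋂ L, ⋂ (_ : L₀ ≤ L), {U | p U L} :=
    (hC.closure_subset_iff.mpr hincl) (hsub hUab)
  simp only [Set.mem_iInter, Set.mem_setOf_eq] at hmem
  exact hmem L hL

/-- **The window hypothesis of crux 5 holds with ONE threshold on a dense subset of a sub-window.**
If the window-average body of `BirEveryGroundState` / `BirGroundStateAverageLRO` holds at every
coupling of `(U₁, U₂)` with a `U`-dependent threshold, then for some threshold `L₀` and some
non-trivial sub-window `(a, b) ⊆ (U₁, U₂)` the couplings at which it holds for ALL even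
`L ≥ L₀` are dense in `(a, b)`. Pure logic over `exists_Ioo_subset_closure_of_forall_eventually`;
nothing about the Hubbard model is used. Baire (1899). [folklore] -/
theorem birAvgHyp_uniform_on_dense_subwindow {δ U₁ U₂ c : ℝ} (hU : U₁ < U₂)
    (h : ∀ U ∈ Set.Ioo U₁ U₂, ∃ L₀ : ℕ, ∀ (L : ℕ) [NeZero L], L₀ ≤ L → Even L →
      let N : ℕ := 2 * ⌊(1 - δ) * (L : ℝ) ^ 2 / 2⌋₊
      let H := hubbardTorus 2 L 1 U
      let S := szSector (Λ := FermionTorus 2 L) N 0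
      let E₀ := S ⊓ Module.End.eigenspace (Matrix.toLin' H) ((H.minEnergyOn S : ℝ) : ℂ)
      let P := projMatrix (E₀.map (Fock.toEuclidean (ι := Orb (FermionTorus 2 L)) :
        Fock (Orb (FermionTorus 2 L)) →ₗ[ℂ] EuclideanSpace ℂ (Finset (Orb (FermionTorus 2 L)))))
      c * (L : ℝ) ^ 4 * P.trace.re ≤
        (P * ((pairField dWaveFormFactor L)ᴴ * pairField dWaveFormFactor L)).trace.re) :
    ∃ (L₀ : ℕ) (a b : ℝ), U₁ < a ∧ a < b ∧ b < U₂ ∧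
      Set.Ioo a b ⊆ closure {U | U ∈ Set.Ioo U₁ U₂ ∧ ∀ (L : ℕ) [NeZero L], L₀ ≤ L → Even L →
        let N : ℕ := 2 * ⌊(1 - δ) * (L : ℝ) ^ 2 / 2⌋₊
        let H := hubbardTorus 2 L 1 U
        let S := szSector (Λ := FermionTorus 2 L) N 0
        let E₀ := S ⊓ Module.End.eigenspace (Matrix.toLin' H) ((H.minEnergyOn S : ℝ) : ℂ)
        let P := projMatrix (E₀.map (Fock.toEuclidean (ι := Orb (FermionTorus 2 L)) :
          Fock (Orb (FermionTorus 2 L)) →ₗ[ℂ] EuclideanSpace ℂ (Finset (Orb (FermionTorus 2 L)))))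
        c * (L : ℝ) ^ 4 * P.trace.re ≤
          (P * ((pairField dWaveFormFactor L)ᴴ * pairField dWaveFormFactor L)).trace.re} := by
  -- the body as a predicate of `(U, L)`, with the side conditions folded in
  let p : ℝ → ℕ → Prop := fun U L => ∀ [NeZero L], Even L →
      let N : ℕ := 2 * ⌊(1 - δ) * (L : ℝ) ^ 2 / 2⌋₊
      let H := hubbardTorus 2 L 1 U
      let S := szSector (Λ := FermionTorus 2 L) N 0
      let E₀ := S ⊓ Module.End.eigenspace (Matrix.toLin' H) ((H.minEnergyOn S : ℝ) : ℂ)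
      let P := projMatrix (E₀.map (Fock.toEuclidean (ι := Orb (FermionTorus 2 L)) :
        Fock (Orb (FermionTorus 2 L)) →ₗ[ℂ] EuclideanSpace ℂ (Finset (Orb (FermionTorus 2 L)))))
      c * (L : ℝ) ^ 4 * P.trace.re ≤
        (P * ((pairField dWaveFormFactor L)ᴴ * pairField dWaveFormFactor L)).trace.re
  have hp : ∀ U ∈ Set.Ioo U₁ U₂, ∃ L₀ : ℕ, ∀ L, L₀ ≤ L → p U L := by
    intro U hUW
    obtain ⟨L₀, hL₀⟩ := h U hUW
    exact ⟨L₀, fun L hL _ hE => hL₀ L hL hE⟩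
  obtain ⟨L₀, a, b, ha, hab, hb, hsub⟩ :=
    exists_Ioo_subset_closure_of_forall_eventually hU p hp
  refine ⟨L₀, a, b, ha, hab, hb, hsub.trans (closure_mono ?_)⟩
  intro V hV
  exact ⟨hV.1, fun L _ hL hE => hV.2 L hL hE⟩

end Summit.HubbardSuperconductivity.HubbardSuperconductivity.Theorems
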